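import Summits.Ventures.LatticeQCDFlow.Scaling.SimulatedTemperingModeBlocks
import Summits.Ventures.LatticeQCDFlow.Scaling.SpiderPoincare
import Summits.Ventures.LatticeQCDFlow.Scaling.SimulatedTemperingFiniteGap
import Summits.Ventures.LatticeQCDFlow.Scaling.LadderFloor

/-!
HONEST FRAMING: exact (Metropolis-corrected) sampling algorithms for lattice gauge theory; figures
of merit are autocorrelation/cost numbers at stated couplings and volumes; no continuum-physics
claim.

# SimulatedTemperingModeGap — TEMPERING BEATS METASTABILITY WHEN THE HOT LEVEL MIXES AND THE MODES PERSIST: ON A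
# FINITE CONFIGURATION SPACE THE SIMULATED-TEMPERING SAMPLER HAS `Gap ≥ min{C/3, C(1−t)γ_A/(3 + C)}` WITH
# `C = (p/(2(K+1)))·min{tδ/K, (1−t)γ₀}` — within-MODE gaps `γ_A`, HOT-LEVEL gap `γ₀`, mode-restricted overlaps `δ`,
# persistence `p`, AND NOTHING ABOUT THE COLD LEVELS' BARRIER CROSSING; at `t = ½`:
# `Gap ≥ pγ_A·min{δ/K, γ₀}/(25(K+1))`, `τ_int(g) ≤ 25(K+1)·max{K/δ, 1/γ₀}/(pγ_A) − ½` FOR EVERY OBSERVABLE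
# (lean-2 GEN-17, ours)

Venture-side (OURS).  Cell `lqcd-flow` (pub-lqcd), unit `pub-lqcd-lean-2-g17`, 2026-08-25.  Assembles chapter Y:
`Scaling/SimulatedTemperingModeBlocks` (the (level, mode) block structure of `P = stFinSampler t μ M`),
`Scaling/SpiderPoincare` (the projection chain's Poincaré constant from persistence, arm flows and the root row) and
the Literature's Jerrum–Son–Tetali–Vigoda Theorem 1 (PROVED in `MarkovChainDecomposition`).  Compare chapter X
(`Scaling/SimulatedTemperingFiniteCeiling`, levels as blocks): `Gap ≥ a·min{1,γ_M}/(8(K+1)²)` with the GLOBAL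
within-level Poincaré constant `γ_M` — exponentially small for a metastable cold level.  Here `γ_M` is replaced by
`γ_A` (each `M_k` restricted to each mode `A_j = {mode = j}`) and `γ₀` (the hottest level `M_0` alone, globally),
at the price of the persistence `p` (`p·μ_l(A_j) ≤ μ_k(A_j)` for `k ≤ l`: a mode keeps the fraction `p` of its weight
when heated) and of mode-restricted overlaps `δ` (`δ·min{μ_l(A_j), μ_{l+1}(A_j)} ≤ Σ_{x ∈ A_j} min{μ_l(x), μ_{l+1}(x)}`).

## What is proved (finite-chain vocabulary of `Literature.Probability.MarkovChains`)

* §1 **`projection_poincare_of_poincare`** (generic): a Poincaré inequality passes to any projection chain.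
* §2 the spider hypotheses for `(π̄, P̄)` along `blk = Prod.map id mode`: `stFinMode_proj_vert` (arm flows
  `≥ (tδ/2)·min`), `stFinMode_proj_row` (root row `= (1/(K+1))·μ_0(A_j)`), `stFinMode_proj_dom` (root-row flows `=`
  `((1−t)/(K+1))·` the flows of the mode projection of `M_0` — domination with `θ = 1 − t`),
  **`stFinMode_projection_poincare`** — `C·Var_π̄ ≤ 𝓔_π̄(P̄)` for `C·K(K+1) ≤ ptδ/2`, `2C(K+1) ≤ pγ₀(1−t)`.
* §3 **`stFinMode_spectralGap_ge`** — JSTV: `Gap(P) ≥ min{C/3, C(1−t)γ_A/(3 + C)}` for every such `C ≥ 0`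
  (`0 < t < 1`, `K ≥ 1`, every mode nonempty).
* §4 `t = ½`, `p, δ, γ_A ≤ 1`: **`stFinModeHalf_spectralGap_ge`** — `Gap ≥ pγ_A·min{δ/K, γ₀}/(25(K+1))`;
  **`stFinModeHalf_asympVar_le`** / **`stFinModeHalf_tauInt_le`** — for EVERY observable `g` (irreducible `M_k`),
  `asympVar(g) ≤ (2·25(K+1)/(pγ_A·min{δ/K,γ₀}) − 1)·Var(g)`, i.e.
  `τ_int(g) ≤ 25(K+1)/(pγ_A·min{δ/K, γ₀}) − ½`: (ladder diffusion `K(K+1)/δ` OR hot relaxation `(K+1)/γ₀`) × within-mode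
  relaxation `1/γ_A` ÷ persistence — independent of how metastable the cold levels are.

Reading (no numerics implied): tempering in the coupling removes a free-energy barrier between sectors exactly when
(i) the hottest level crosses sectors (`γ₀`), (ii) every level equilibrates inside each sector (`γ_A`), (iii) adjacent
levels overlap inside each sector (`δ`), (iv) sector weights persist down the ladder (`p`); the converse
(`Scaling/SimulatedTemperingModeTorpid`) shows (i)/(iv) cannot be dropped: the gap is at most the ladder-averaged
sector exit flow.  NOT CLAIMED: sharp constants (`25`, JSTV's `3`); non-uniform persistence profiles (a mode absent
from the hot level is exactly the torpid case); replica exchange; general configuration spaces; anything measured.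
Literature grade (cell rule): KNOWN MECHANISM (Madras–Zheng 2003; Woodard–Schmidler–Huber, Ann. Appl. Probab. 19
(2009) 617–640 — rapid mixing of tempering from persistence, via decomposition), NEW TYPING (explicit constants for the
exact-weight finite sampler with arbitrary exact within-level updates); nothing cited as a fact; no new bib keys.
-/

noncomputable section

open Finset
open Literature.Probability.MarkovChains
open Literature.Probability.MarkovChains.Decomposition

namespace Summit.Ventures.LatticeQCDFlow.Scaling

/-! ## §1 A Poincaré inequality passes to the projection chain -/

section Projection

variable {X I : Type*} [Fintype X] [Fintype I] [DecidableEq I]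

/-- **A Poincaré inequality is inherited by the projection chain with the same constant:** test the original
inequality on functions constant on blocks (`Var_π(g∘blk) = Var_π̄(g)`, `𝓔_π(P; g∘blk) = 𝓔_π̄(P̄; g)`). [ours] -/
theorem projection_poincare_of_poincare {π : X → ℝ} {P : Matrix X X ℝ} {blk : X → I}
    (hM : ∀ i, blockMass π blk i ≠ 0) {γ : ℝ}
    (hgap : ∀ f : X → ℝ, γ * lawVariance π f ≤ dirichletForm π P f) (g : I → ℝ) :
    γ * lawVariance (blockMass π blk) g ≤ dirichletForm (blockMass π blk) (projectionChain π P blk) g := by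
  have h1 := hgap (fun x => g (blk x))
  rw [lawVariance_comp_blk, dirichletForm_comp_blk] at h1
  rw [dirichletForm_projectionChain hM]
  have h2 : ∀ i, ∑ j ∈ univ.erase i, blockFlow π P blk i j * (g i - g j) ^ 2
      = ∑ j, blockFlow π P blk i j * (g i - g j) ^ 2 :=
    fun i => Finset.sum_erase univ (by simp)
  simp_rw [h2]
  exact h1

end Projection

/-! ## §2 The spider hypotheses for the projection chain along `(level, mode)` -/

section Mode

variable {S J : Type*} [Fintype S] [DecidableEq S] [Fintype J] [DecidableEq J] {K : ℕ}
  {μ : Fin (K + 1) → S → ℝ} {M : Fin (K + 1) → Matrix S S ℝ} {t : ℝ} {mode : S → J}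

variable (hμ : ∀ k x, 0 < μ k x) (hμ1 : ∀ k, ∑ x, μ k x = 1) (hmode : Function.Surjective mode)
include hμ hμ1 hmode

omit [DecidableEq S] [Fintype J] hμ1 in
/-- Every block `(k, j)` has positive mass. [ours] -/
theorem stFinMode_blockMass_ne (b : Fin (K + 1) × J) : blockMass (stFinLaw μ) (Prod.map id mode) b ≠ 0 :=
  (blockMass_pos (stFinLaw_pos hμ) (modeBlk_surjective hmode) b).ne'

omit [Fintype J] hμ1 hmode in
/-- **Arm flows:** `π̄(l,j)P̄((l,j),(l+1,j)) = t·Σ_{x ∈ A_j} min{μ_l, μ_{l+1}}/(2(K+1)) ≥ (tδ/2)·min{π̄(l,j), π̄(l+1,j)}`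
when `δ·min{μ_l(A_j), μ_{l+1}(A_j)} ≤ Σ_{x ∈ A_j} min{μ_l(x), μ_{l+1}(x)}` (`t ≥ 0`). [ours] -/
theorem stFinMode_proj_vert (hmode : Function.Surjective mode) (ht0 : 0 ≤ t) {δ : ℝ}
    (hδ : ∀ (l : Fin K) (j : J), δ * min (blockMass (μ l.castSucc) mode j) (blockMass (μ l.succ) mode j)
      ≤ ∑ x ∈ block mode j, min (μ l.castSucc x) (μ l.succ x))
    (l : Fin K) (j : J) :
    t * δ / 2 * min (blockMass (stFinLaw μ) (Prod.map id mode) (l.castSucc, j))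
        (blockMass (stFinLaw μ) (Prod.map id mode) (l.succ, j))
      ≤ blockMass (stFinLaw μ) (Prod.map id mode) (l.castSucc, j)
          * projectionChain (stFinLaw μ) (stFinSampler t μ M) (Prod.map id mode) (l.castSucc, j) (l.succ, j) := by
  have hne : l.castSucc ≠ l.succ := ne_of_lt Fin.castSucc_lt_succ
  rw [blockMass_mul_projectionChain (stFinMode_blockMass_ne hμ hmode _),
    stFinMode_blockFlow_vert hμ hne j,
    if_pos (Or.inl (by simp [Fin.val_succ])), stFinMode_blockMass, stFinMode_blockMass,
    min_div_div_right (by positivity : (0 : ℝ) ≤ (K : ℝ) + 1)]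
  have hK : (0 : ℝ) < K + 1 := by positivity
  have e : t * δ / 2 * (min (blockMass (μ l.castSucc) mode j) (blockMass (μ l.succ) mode j) / (K + 1))
      = t * (δ * min (blockMass (μ l.castSucc) mode j) (blockMass (μ l.succ) mode j)) / (2 * (K + 1)) := by
    field_simp
  rw [e]
  exact div_le_div_of_nonneg_right (mul_le_mul_of_nonneg_left (hδ l j) ht0) (by positivity)

omit [DecidableEq S] [Fintype J] hμ hμ1 hmode in
/-- **Root row:** `π̄(0, j) = (1/(K+1))·μ_0(A_j)`. [ours] -/
theorem stFinMode_proj_row (j : J) :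
    blockMass (stFinLaw μ) (Prod.map id mode) (0, j) = 1 / (K + 1) * blockMass (μ 0) mode j := by
  rw [stFinMode_blockMass]
  ring

omit [Fintype J] hμ1 in
/-- **Root-row flows are the mode-projection flows of the hot update, slowed by `1 − t`:**
`(1−t)·(1/(K+1))·(μ̄_0(j)·P̄_0(j,j′)) = π̄(0,j)P̄((0,j),(0,j′))` (`j ≠ j′`), `P̄_0` the projection of `M_0` on the
modes. [ours] -/
theorem stFinMode_proj_dom {j j' : J} (hjj : j ≠ j') :
    (1 - t) * (1 / (K + 1) * (blockMass (μ 0) mode j * projectionChain (μ 0) (M 0) mode j j'))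
      = blockMass (stFinLaw μ) (Prod.map id mode) (0, j)
          * projectionChain (stFinLaw μ) (stFinSampler t μ M) (Prod.map id mode) (0, j) (0, j') := by
  rw [blockMass_mul_projectionChain ((blockMass_pos (hμ 0) hmode j).ne'),
    blockMass_mul_projectionChain (stFinMode_blockMass_ne hμ hmode _), stFinMode_blockFlow_horiz 0 hjj]
  ring

/-- **THE PROJECTION CHAIN'S POINCARÉ CONSTANT** (spider Poincaré inequality with `κ = tδ/2`, `ρ = γ₀`,
`θ = 1 − t`, `M₀ = 1/(K+1)`): persistence `p`, mode-restricted overlaps `δ`, a GLOBAL Poincaré constant `γ₀` of the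
hottest update `M_0` ⇒ `C·Var_π̄(g) ≤ 𝓔_π̄(P̄; g)` for every `C ≥ 0` with `C·K(K+1) ≤ ptδ/2` and
`2C(K+1) ≤ pγ₀(1−t)`. [ours] -/
theorem stFinMode_projection_poincare (hM : ∀ k, IsRowStochastic (M k))
    (hMrev : ∀ k, DetailedBalance (μ k) (M k)) (ht0 : 0 ≤ t) (ht1 : t ≤ 1)
    {p δ γ₀ : ℝ} (hp : 0 < p) (hδ0 : 0 < δ) (hγ₀ : 0 < γ₀)
    (hpers : ∀ (k l : Fin (K + 1)) (j : J), k ≤ l → p * blockMass (μ l) mode j ≤ blockMass (μ k) mode j)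
    (hδ : ∀ (l : Fin K) (j : J), δ * min (blockMass (μ l.castSucc) mode j) (blockMass (μ l.succ) mode j)
      ≤ ∑ x ∈ block mode j, min (μ l.castSucc x) (μ l.succ x))
    (hgap0 : ∀ h : S → ℝ, γ₀ * lawVariance (μ 0) h ≤ dirichletForm (μ 0) (M 0) h)
    {C : ℝ} (hC0 : 0 ≤ C) (hC1 : C * (K * (K + 1)) ≤ p * (t * δ / 2)) (hC2 : C * (2 * (K + 1)) ≤ p * γ₀ * (1 - t))
    (ht0' : 0 < t) (ht1' : t < 1) (g : Fin (K + 1) × J → ℝ) :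
    C * lawVariance (blockMass (stFinLaw μ) (Prod.map id mode)) g
      ≤ dirichletForm (blockMass (stFinLaw μ) (Prod.map id mode))
          (projectionChain (stFinLaw μ) (stFinSampler t μ M) (Prod.map id mode)) g := by
  have hπ0 : ∀ q, 0 ≤ stFinLaw μ q := fun q => (stFinLaw_pos hμ q).le
  have hP := stFinSampler_isRowStochastic (M := M) hμ hM ht0 ht1
  have hne := stFinMode_blockMass_ne (K := K) hμ hmode
  refine spider_poincare (m := blockMass (stFinLaw μ) (Prod.map id mode))
    (Q := projectionChain (stFinLaw μ) (stFinSampler t μ M) (Prod.map id mode))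
    (fun b => blockMass_nonneg hπ0 _ b) ?_ (projectionChain_nonneg hπ0 hP.1 _)
    (projectionChain_detailedBalance (stFinSampler_detailedBalance hμ hMrev) hne)
    hp (by positivity : 0 < t * δ / 2) hγ₀ (by linarith : 0 < 1 - t) (by positivity : (0 : ℝ) ≤ 1 / (K + 1))
    ?_ (stFinMode_proj_vert (M := M) hμ hmode ht0 hδ) (ν := blockMass (μ 0) mode) stFinMode_proj_row
    (Q₀ := projectionChain (μ 0) (M 0) mode)
    (projection_poincare_of_poincare (fun j => (blockMass_pos (hμ 0) hmode j).ne') hgap0)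
    (fun j j' hjj => le_of_eq (stFinMode_proj_dom (M := M) (t := t) hμ hmode hjj)) hC0 hC1 hC2 g
  · rw [sum_blockMass, sum_stFinLaw hμ1]
  · intro k l j hkl
    rw [stFinMode_blockMass, stFinMode_blockMass, mul_div_assoc']
    exact div_le_div_of_nonneg_right (hpers k l j hkl) (by positivity)

/-! ## §3 The spectral gap -/

/-- **THE SPECTRAL GAP OF THE SIMULATED-TEMPERING SAMPLER FROM WITHIN-MODE GAPS, THE HOT-LEVEL GAP, RESTRICTED
OVERLAPS AND PERSISTENCE** (Jerrum–Son–Tetali–Vigoda Theorem 1 with the (level, mode) blocks):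
`Gap(stFinSampler t μ M) ≥ min{C/3, C(1−t)γ_A/(3 + C)}` for every `C ≥ 0` with `C·K(K+1) ≤ ptδ/2`,
`2C(K+1) ≤ pγ₀(1−t)` — NO hypothesis on the cold levels' global mixing. [ours] -/
theorem stFinMode_spectralGap_ge (hK : 1 ≤ K) (hM : ∀ k, IsRowStochastic (M k))
    (hMrev : ∀ k, DetailedBalance (μ k) (M k)) (ht0 : 0 < t) (ht1 : t < 1)
    {p δ γ₀ γA : ℝ} (hp : 0 < p) (hδ0 : 0 < δ) (hγ₀ : 0 < γ₀) (hγA : 0 < γA)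
    (hpers : ∀ (k l : Fin (K + 1)) (j : J), k ≤ l → p * blockMass (μ l) mode j ≤ blockMass (μ k) mode j)
    (hδ : ∀ (l : Fin K) (j : J), δ * min (blockMass (μ l.castSucc) mode j) (blockMass (μ l.succ) mode j)
      ≤ ∑ x ∈ block mode j, min (μ l.castSucc x) (μ l.succ x))
    (hgap0 : ∀ h : S → ℝ, γ₀ * lawVariance (μ 0) h ≤ dirichletForm (μ 0) (M 0) h)
    (hgapA : ∀ k j, ∀ h : S → ℝ, γA * lawVariance (blockLaw (μ k) mode j) h
      ≤ dirichletForm (blockLaw (μ k) mode j) (restrictionChain (M k) mode) h)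
    {C : ℝ} (hC0 : 0 < C) (hC1 : C * (K * (K + 1)) ≤ p * (t * δ / 2)) (hC2 : C * (2 * (K + 1)) ≤ p * γ₀ * (1 - t)) :
    min (C / 3) (C * ((1 - t) * γA) / (3 * 1 + C))
      ≤ spectralGap (stFinLaw μ) (stFinSampler t μ M) := by
  haveI : Nonempty S := by
    by_contra h
    rw [not_nonempty_iff] at h
    have := hμ1 0
    rw [Finset.univ_eq_empty, Finset.sum_empty] at this
    exact zero_ne_one this
  haveI : Nontrivial (Fin (K + 1)) := Fin.nontrivial_iff_two_le.mpr (by omega)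
  exact JerrumEtAl2004_thm_1_spectralGap (stFinLaw_pos hμ) (sum_stFinLaw hμ1)
    (stFinSampler_isRowStochastic hμ hM ht0.le ht1.le) (stFinSampler_detailedBalance hμ hMrev)
    (modeBlk_surjective hmode) hC0 (mul_pos (by linarith) hγA) zero_le_one
    (stFinMode_projection_poincare hμ hμ1 hmode hM hMrev ht0.le ht1.le hp hδ0 hγ₀ hpers hδ hgap0 hC0.le hC1 hC2
      ht0 ht1)
    (stFinMode_restriction_poincare ht1.le hgapA)
    (stFinMode_escapeProb_le_one (M := M) hμ hM ht0.le ht1.le)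

/-! ## §4 The half-half scan in closed form, and the ceiling for every observable -/

/-- **`t = ½`: `Gap ≥ pγ_A·min{δ/K, γ₀}/(25(K+1))`** (`p, δ, γ_A ≤ 1`, `K ≥ 1`). [ours] -/
theorem stFinModeHalf_spectralGap_ge (hK : 1 ≤ K) (hM : ∀ k, IsRowStochastic (M k))
    (hMrev : ∀ k, DetailedBalance (μ k) (M k))
    {p δ γ₀ γA : ℝ} (hp : 0 < p) (hp1 : p ≤ 1) (hδ0 : 0 < δ) (hδ1 : δ ≤ 1) (hγ₀ : 0 < γ₀)
    (hγA : 0 < γA) (hγA1 : γA ≤ 1)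
    (hpers : ∀ (k l : Fin (K + 1)) (j : J), k ≤ l → p * blockMass (μ l) mode j ≤ blockMass (μ k) mode j)
    (hδ : ∀ (l : Fin K) (j : J), δ * min (blockMass (μ l.castSucc) mode j) (blockMass (μ l.succ) mode j)
      ≤ ∑ x ∈ block mode j, min (μ l.castSucc x) (μ l.succ x))
    (hgap0 : ∀ h : S → ℝ, γ₀ * lawVariance (μ 0) h ≤ dirichletForm (μ 0) (M 0) h)
    (hgapA : ∀ k j, ∀ h : S → ℝ, γA * lawVariance (blockLaw (μ k) mode j) h
      ≤ dirichletForm (blockLaw (μ k) mode j) (restrictionChain (M k) mode) h) :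
    p * γA * min (δ / K) γ₀ / (25 * (K + 1))
      ≤ spectralGap (stFinLaw μ) (stFinSampler (1 / 2) μ M) := by
  have hKr : (1 : ℝ) ≤ K := by exact_mod_cast hK
  have hK0 : (0 : ℝ) < K := by linarith
  set m₀ := min (δ / K) γ₀ with hm₀
  have hm₀pos : 0 < m₀ := lt_min (div_pos hδ0 hK0) hγ₀
  have hm₀le : m₀ ≤ 1 := (min_le_left _ _).trans ((div_le_one hK0).mpr (hδ1.trans hKr))
  -- the admissible constant `C = p·m₀/(4(K+1))`
  set C := p * m₀ / (4 * (K + 1)) with hC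
  have hCpos : 0 < C := by positivity
  have hC1 : C * (K * (K + 1)) ≤ p * ((1 / 2 : ℝ) * δ / 2) := by
    rw [hC]
    have h1 : m₀ * K ≤ δ := by
      have := min_le_left (δ / K) γ₀
      rw [← hm₀] at this
      calc m₀ * K ≤ δ / K * K := mul_le_mul_of_nonneg_right this hK0.le
        _ = δ := div_mul_cancel₀ δ hK0.ne'
    have e : p * m₀ / (4 * (K + 1)) * (K * (K + 1)) = p * (m₀ * K) / 4 := by field_simp
    rw [e]
    have : p * (m₀ * K) ≤ p * δ := mul_le_mul_of_nonneg_left h1 hp.le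
    linarith
  have hC2 : C * (2 * (K + 1)) ≤ p * γ₀ * (1 - 1 / 2) := by
    rw [hC]
    have h1 : m₀ ≤ γ₀ := min_le_right _ _
    have e : p * m₀ / (4 * (K + 1)) * (2 * (K + 1)) = p * m₀ / 2 := by
      field_simp
      norm_num
    rw [e]
    have : p * m₀ ≤ p * γ₀ := mul_le_mul_of_nonneg_left h1 hp.le
    linarith
  have key := stFinMode_spectralGap_ge hμ hμ1 hmode hK hM hMrev (by norm_num : (0 : ℝ) < 1 / 2)
    (by norm_num : (1 / 2 : ℝ) < 1) hp hδ0 hγ₀ hγA hpers hδ hgap0 hgapA hCpos hC1 hC2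
  refine le_trans ?_ key
  -- `C ≤ 1/8`, so `min{C/3, C·(γ_A/2)/(3 + C)} ≥ 4Cγ_A/25 = pγ_A m₀/(25(K+1))`
  have hCle : C ≤ 1 / 8 := by
    rw [hC, div_le_iff₀ (by positivity)]
    have : p * m₀ ≤ 1 * 1 := mul_le_mul hp1 hm₀le hm₀pos.le zero_le_one
    have hK1 : (2 : ℝ) ≤ K + 1 := by linarith
    nlinarith
  have hval : p * γA * m₀ / (25 * (K + 1)) = 4 * C * γA / 25 := by
    rw [hC]
    field_simp
  rw [hval]
  refine le_min ?_ ?_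
  · -- `4CγA/25 ≤ C/3`
    rw [div_le_div_iff₀ (by norm_num) (by norm_num)]
    nlinarith [mul_le_mul_of_nonneg_left hγA1 hCpos.le]
  · -- `4CγA/25 ≤ C(γA/2)/(3 + C)`
    rw [show (1 : ℝ) - 1 / 2 = 1 / 2 by norm_num, div_le_div_iff₀ (by norm_num) (by positivity)]
    nlinarith [mul_pos hCpos hγA, hCle]

/-- **THE CEILING FOR EVERY OBSERVABLE at `t = ½`:** with irreducible within-level updates,
`asympVar(g) ≤ (2·25(K+1)/(pγ_A·min{δ/K, γ₀}) − 1)·Var_π(g)`. [ours] -/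
theorem stFinModeHalf_asympVar_le (hK : 1 ≤ K) (hM : ∀ k, IsRowStochastic (M k))
    (hMrev : ∀ k, DetailedBalance (μ k) (M k)) (hMirr : ∀ k, IsIrreducible (M k))
    {p δ γ₀ γA : ℝ} (hp : 0 < p) (hp1 : p ≤ 1) (hδ0 : 0 < δ) (hδ1 : δ ≤ 1) (hγ₀ : 0 < γ₀)
    (hγA : 0 < γA) (hγA1 : γA ≤ 1)
    (hpers : ∀ (k l : Fin (K + 1)) (j : J), k ≤ l → p * blockMass (μ l) mode j ≤ blockMass (μ k) mode j)
    (hδ : ∀ (l : Fin K) (j : J), δ * min (blockMass (μ l.castSucc) mode j) (blockMass (μ l.succ) mode j)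
      ≤ ∑ x ∈ block mode j, min (μ l.castSucc x) (μ l.succ x))
    (hgap0 : ∀ h : S → ℝ, γ₀ * lawVariance (μ 0) h ≤ dirichletForm (μ 0) (M 0) h)
    (hgapA : ∀ k j, ∀ h : S → ℝ, γA * lawVariance (blockLaw (μ k) mode j) h
      ≤ dirichletForm (blockLaw (μ k) mode j) (restrictionChain (M k) mode) h)
    (g : Fin (K + 1) × S → ℝ) :
    asympVar g (stFinLaw μ) (stFinSampler (1 / 2) μ M)
      ≤ (2 / (p * γA * min (δ / K) γ₀ / (25 * (K + 1))) - 1) * lawVariance (stFinLaw μ) g := by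
  haveI : Nonempty S := by
    by_contra h
    rw [not_nonempty_iff] at h
    have := hμ1 0
    rw [Finset.univ_eq_empty, Finset.sum_empty] at this
    exact zero_ne_one this
  haveI : Nontrivial (Fin (K + 1)) := Fin.nontrivial_iff_two_le.mpr (by omega)
  have ht0 : (0 : ℝ) < 1 / 2 := by norm_num
  have ht1 : (1 / 2 : ℝ) < 1 := by norm_num
  have hP := stFinSampler_isRowStochastic (M := M) hμ hM ht0.le ht1.le
  have hDB := stFinSampler_detailedBalance (t := (1 / 2 : ℝ)) (M := M) hμ hMrev
  have hirr := stFinSampler_isIrreducible hμ hM hMirr ht0 ht1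
  have h1 := asympVar_le_spectralGap (stFinLaw_pos hμ) (sum_stFinLaw hμ1) hP hDB hirr g
  have hc := stFinModeHalf_spectralGap_ge hμ hμ1 hmode hK hM hMrev hp hp1 hδ0 hδ1 hγ₀ hγA hγA1 hpers hδ hgap0 hgapA
  have hKr : (1 : ℝ) ≤ K := by exact_mod_cast hK
  have hcpos : 0 < p * γA * min (δ / K) γ₀ / (25 * (K + 1)) := by
    have : 0 < min (δ / K) γ₀ := lt_min (div_pos hδ0 (by linarith)) hγ₀
    positivity
  refine h1.trans (mul_le_mul_of_nonneg_right ?_ (lawVariance_nonneg (fun q => (stFinLaw_pos hμ q).le) g))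
  have := div_le_div_of_nonneg_left (by norm_num : (0 : ℝ) ≤ 2) hcpos hc
  linarith

/-- **`τ_int(g) ≤ 25(K+1)/(pγ_A·min{δ/K, γ₀}) − ½` for every non-constant observable** (`t = ½`):
`asympVar(g)/(2Var(g)) ≤ 25(K+1)/(pγ_A·min{δ/K, γ₀}) − ½` — ladder diffusion or hot relaxation, times within-mode
relaxation, over persistence; the cold levels' barrier crossing never enters. [ours] -/
theorem stFinModeHalf_tauInt_le (hK : 1 ≤ K) (hM : ∀ k, IsRowStochastic (M k))
    (hMrev : ∀ k, DetailedBalance (μ k) (M k)) (hMirr : ∀ k, IsIrreducible (M k))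
    {p δ γ₀ γA : ℝ} (hp : 0 < p) (hp1 : p ≤ 1) (hδ0 : 0 < δ) (hδ1 : δ ≤ 1) (hγ₀ : 0 < γ₀)
    (hγA : 0 < γA) (hγA1 : γA ≤ 1)
    (hpers : ∀ (k l : Fin (K + 1)) (j : J), k ≤ l → p * blockMass (μ l) mode j ≤ blockMass (μ k) mode j)
    (hδ : ∀ (l : Fin K) (j : J), δ * min (blockMass (μ l.castSucc) mode j) (blockMass (μ l.succ) mode j)
      ≤ ∑ x ∈ block mode j, min (μ l.castSucc x) (μ l.succ x))
    (hgap0 : ∀ h : S → ℝ, γ₀ * lawVariance (μ 0) h ≤ dirichletForm (μ 0) (M 0) h)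
    (hgapA : ∀ k j, ∀ h : S → ℝ, γA * lawVariance (blockLaw (μ k) mode j) h
      ≤ dirichletForm (blockLaw (μ k) mode j) (restrictionChain (M k) mode) h)
    {g : Fin (K + 1) × S → ℝ} (hg : 0 < lawVariance (stFinLaw μ) g) :
    asympVar g (stFinLaw μ) (stFinSampler (1 / 2) μ M) / (2 * lawVariance (stFinLaw μ) g)
      ≤ 25 * (K + 1) / (p * γA * min (δ / K) γ₀) - 1 / 2 := by
  have h := stFinModeHalf_asympVar_le hμ hμ1 hmode hK hM hMrev hMirr hp hp1 hδ0 hδ1 hγ₀ hγA hγA1 hpers hδ hgap0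
    hgapA g
  have hKr : (1 : ℝ) ≤ K := by exact_mod_cast hK
  have hm : 0 < min (δ / K) γ₀ := lt_min (div_pos hδ0 (by linarith)) hγ₀
  have hc : 0 < p * γA * min (δ / K) γ₀ := by positivity
  rw [div_le_iff₀ (by positivity)]
  have e : (25 * (K + 1) / (p * γA * min (δ / K) γ₀) - 1 / 2) * (2 * lawVariance (stFinLaw μ) g)
      = (2 / (p * γA * min (δ / K) γ₀ / (25 * (K + 1))) - 1) * lawVariance (stFinLaw μ) g := by
    field_simp
  rw [e]
  exact h

end Mode

end Summit.Ventures.LatticeQCDFlow.Scaling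

end
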